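import Summits.ResolutionOfSingularities.ResolutionOfSingularities.Theorems.PurelyInseparableDim4PhiLineStepResidual
import HarnessLib

/-!
# (K-Φ2) chain dictionary III: LINEAR FRAMES of `𝒪 = K[x]_{𝔪₀}` — they generate `𝔪`; units, powers of `𝔪`, the label ideal

Cell `res-dim4-pi` (D-0157 DOOR 2), Φ = β_h line of res-dim4-idea-1 (CARD I-1-8: «carry (y₁, y₂; u₁ = x_h, u₂) by strict transforms»; crit-2 g3
V-B-62: the carried label is ALWAYS LINEAR). The binders `hgena`/`hgens`/`hJ` of `PhiLine.keepCount_add_betaS_le_of_betaS_le` and the inputs of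
(K-Φ3) IV/V for a frame made of LINEAR FORMS `c i = (Σ_s L_{i s} x_s)/1 ∈ 𝒪 = OriginLocalization K 4`, DEF-FREE (`L : Fin (r+2) → Fin 4 → K` any
coefficient table; in the cell `r = 2` and rows `u₁ = e_h`, `u₂ = e_m`):

* §1 `originIdeal_eq_idealOfVars`, `algebraMap_mem_maximalIdeal_pow_of_le_ordZero` (`d ≤ ord₀ G ⇒ G/1 ∈ 𝔪^d`: the `hJ` binder for
  `J = (G/1)`), `span_singleton_algebraMap_le_maximalIdeal_pow`;
* §2 `isUnit_algebraMap_of_constantCoeff_ne_zero` (a polynomial with `ε(0) ≠ 0` is a unit of `𝒪` — the `ε` of (K-Φ2) II),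
  `algebraMap_mem_span_pow_of_mem_span_pow` (`R ∈ (x_h^a)`, `d ≤ a` ⇒ `R/1 ∈ ((x_h/1)^d)` — the `ρ` of (K-Φ3) V);
* §3 **`span_range_linearFrame_eq_maximalIdeal`**: if the rows of `L` span all linear forms (witnessed by a left inverse `M`,
  `Σ_i M_{t i} L_{i s} = δ_{t s}`), the frame generates `𝔪` (`hgena`/`hgens`);
* §4 the label ideal: `yIdeal_linearFrame` (`yIdeal c = ((Σ L_{0 s} x_s)/1, …)`), **`algebraMap_mem_yIdeal_pow_sup`**: the polynomial condition
  `G ∈ (ℓ_y)^d + 𝔪₀^{d+1}` gives `G/1 ∈ yIdeal c ^ d ⊔ 𝔪^{d+1}`, i.e. `δ > 1` by (K-Φ3) IV `factorial_lt_deltaS_of_le_yIdeal_pow_sup`.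

[OURS · counted 0 · AI work weaker than expert review.] Nothing here proves K2(p), the β_h line, or resolution of singularities in dimension ≥ 4 /
characteristic p.

Sources: V. Cossart, U. Jannsen, S. Saito, LNM **2270** (2020), Def. 8.4, (12.1) [`CossartJannsenSaito2020`]; V. Cossart, O. Piltant, J. Algebra 320
(2008) §4 p. 11 («`(y, u₁, u₂)` such that `T_x = k(x)·Y`») [`CossartPiltant2008`].
-/

set_option linter.dupNamespace false

noncomputable section

namespace Summit.ResolutionOfSingularities.ResolutionOfSingularities.Theorems.PIDim4

namespace PhiLine

open MvPolynomial Finset IsLocalRing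
open Literature.AlgebraicGeometry.Resolution
open Literature.AlgebraicGeometry.Resolution.Hauser2010
open Literature.AlgebraicGeometry.Resolution.WeightedOrder (yIdeal yPart)

variable {K : Type} [Field K]

/-! ## §1 Powers of the maximal ideal -/

/-- `𝔪_𝒪 = 𝔪₀ · 𝒪`. [folklore] -/
theorem maximalIdeal_originLocalization_eq_map :
    maximalIdeal (OriginLocalization K 4) =
      (Literature.AlgebraicGeometry.Resolution.originIdeal K 4).map (algebraMap (MvPolynomial (Fin 4) K) (OriginLocalization K 4)) :=
  (Localization.AtPrime.map_eq_maximalIdeal).symm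

/-- The tree's two spellings of `𝔪₀ ⊂ K[x₁, …, x₄]` agree with Mathlib's `idealOfVars`. [folklore] -/
theorem originIdeal_eq_idealOfVars :
    Literature.AlgebraicGeometry.Resolution.originIdeal K 4 = MvPolynomial.idealOfVars (Fin 4) K := by
  rw [Literature.AlgebraicGeometry.Resolution.originIdeal_eq_span]

/-- **`d ≤ ord₀ G ⇒ G/1 ∈ 𝔪^d`** in `𝒪`. [cite: ZariskiSamuel1960, Vol. II Ch. VII §1 p.130] -/
theorem algebraMap_mem_maximalIdeal_pow_of_le_ordZero {d : ℕ} {G : MvPolynomial (Fin 4) K} (hd : (d : ℕ∞) ≤ ordZero G) :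
    algebraMap (MvPolynomial (Fin 4) K) (OriginLocalization K 4) G ∈ maximalIdeal (OriginLocalization K 4) ^ d := by
  rw [maximalIdeal_originLocalization_eq_map, ← Ideal.map_pow]
  refine Ideal.mem_map_of_mem _ ?_
  rw [originIdeal_eq_idealOfVars]
  exact (natCast_le_ordZero_iff_mem_idealOfVars_pow G d).mp hd

/-- The `hJ` binder: `(G/1) ⊆ 𝔪^d` when `d ≤ ord₀ G`. [cite: CossartJannsenSaito2020, Def. 8.4] -/
theorem span_singleton_algebraMap_le_maximalIdeal_pow {d : ℕ} {G : MvPolynomial (Fin 4) K} (hd : (d : ℕ∞) ≤ ordZero G) :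
    Ideal.span {algebraMap (MvPolynomial (Fin 4) K) (OriginLocalization K 4) G} ≤ maximalIdeal (OriginLocalization K 4) ^ d := by
  rw [Ideal.span_singleton_le_iff_mem]
  exact algebraMap_mem_maximalIdeal_pow_of_le_ordZero hd

/-! ## §2 Units and the cleaning ideal in `𝒪` -/

/-- A polynomial with `ε(0) ≠ 0` becomes a unit in `𝒪`. [folklore] -/
theorem isUnit_algebraMap_of_constantCoeff_ne_zero {ε : MvPolynomial (Fin 4) K} (hε : constantCoeff ε ≠ 0) :
    IsUnit (algebraMap (MvPolynomial (Fin 4) K) (OriginLocalization K 4) ε) := by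
  refine IsLocalization.map_units (M := (Literature.AlgebraicGeometry.Resolution.originIdeal K 4).primeCompl) (OriginLocalization K 4)
    ⟨ε, ?_⟩
  intro h
  exact hε ((Literature.AlgebraicGeometry.Resolution.mem_originIdeal_iff K 4).mp h)

/-- `R ∈ (x_h^a)` with `d ≤ a` gives `R/1 ∈ ((x_h/1)^d)`. [folklore] -/
theorem algebraMap_mem_span_pow_of_mem_span_pow {h : Fin 4} {a d : ℕ} (hda : d ≤ a) {R : MvPolynomial (Fin 4) K}
    (hR : R ∈ Ideal.span {(X h : MvPolynomial (Fin 4) K) ^ a}) :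
    algebraMap (MvPolynomial (Fin 4) K) (OriginLocalization K 4) R ∈
      Ideal.span {(algebraMap (MvPolynomial (Fin 4) K) (OriginLocalization K 4) (X h)) ^ d} := by
  obtain ⟨q, rfl⟩ := Ideal.mem_span_singleton'.mp hR
  obtain ⟨k, rfl⟩ := Nat.exists_eq_add_of_le hda
  rw [map_mul, map_pow, Ideal.mem_span_singleton]
  exact Dvd.dvd.mul_left (pow_dvd_pow (algebraMap (MvPolynomial (Fin 4) K) (OriginLocalization K 4) (X h)) (Nat.le_add_right d k)) _

/-! ## §3 A linear frame generates `𝔪` -/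

/-- If the rows of `L` have a left inverse `M` on the variables (`Σ_i M_{t i} L_{i s} = δ_{t s}`), every variable is a combination of the
frame's linear forms: `x_t = Σ_i M_{t i} · (Σ_s L_{i s} x_s)`. [folklore] -/
theorem X_eq_sum_of_leftInverse {ι : Type*} [Fintype ι] (L : ι → Fin 4 → K) (M : Fin 4 → ι → K)
    (hM : ∀ t s, ∑ i, M t i * L i s = if t = s then 1 else 0) (t : Fin 4) :
    (X t : MvPolynomial (Fin 4) K) = ∑ i, C (M t i) * ∑ s, C (L i s) * X s := by
  have key : ∑ i, C (M t i) * ∑ s, C (L i s) * (X s : MvPolynomial (Fin 4) K) = ∑ s, C (∑ i, M t i * L i s) * X s := by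
    simp only [Finset.mul_sum, map_sum, Finset.sum_mul]
    rw [Finset.sum_comm]
    refine Finset.sum_congr rfl fun s _ => Finset.sum_congr rfl fun i _ => ?_
    rw [map_mul]; ring
  rw [key]
  have hterm : ∀ s, C (∑ i, M t i * L i s) * (X s : MvPolynomial (Fin 4) K) = if t = s then X s else 0 := by
    intro s
    rw [hM]
    split_ifs
    · rw [C_1, one_mul]
    · rw [C_0, zero_mul]
  rw [Finset.sum_congr rfl (fun s _ => hterm s), Finset.sum_ite_eq, if_pos (Finset.mem_univ _)]

/-- **A linear frame generates the maximal ideal of `𝒪`**: for any coefficient table `L` with a left inverse on the variables,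
`((Σ_s L_{i s} x_s)/1 : i) ` generate `𝔪` — the `hgena`/`hgens` binders. [cite: CossartPiltant2008, §4 p. 11] -/
theorem span_range_linearFrame_eq_maximalIdeal {ι : Type*} [Fintype ι] (L : ι → Fin 4 → K) (M : Fin 4 → ι → K)
    (hM : ∀ t s, ∑ i, M t i * L i s = if t = s then 1 else 0) :
    Ideal.span (Set.range fun i => algebraMap (MvPolynomial (Fin 4) K) (OriginLocalization K 4) (∑ s, C (L i s) * X s)) =
      maximalIdeal (OriginLocalization K 4) := by
  have hpoly : Ideal.span (Set.range fun i => (∑ s, C (L i s) * X s : MvPolynomial (Fin 4) K)) =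
      Literature.AlgebraicGeometry.Resolution.originIdeal K 4 := by
    refine le_antisymm ?_ ?_
    · rw [Ideal.span_le]
      rintro _ ⟨i, rfl⟩
      rw [SetLike.mem_coe, Literature.AlgebraicGeometry.Resolution.mem_originIdeal_iff]
      simp [map_sum, constantCoeff_X]
    · rw [Literature.AlgebraicGeometry.Resolution.originIdeal_eq_span, Ideal.span_le]
      rintro _ ⟨t, rfl⟩
      rw [SetLike.mem_coe, X_eq_sum_of_leftInverse L M hM t]
      exact Ideal.sum_mem _ fun i _ => Ideal.mul_mem_left _ _ (Ideal.subset_span ⟨i, rfl⟩)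
  rw [maximalIdeal_originLocalization_eq_map]
  have h2 := congrArg (Ideal.map (algebraMap (MvPolynomial (Fin 4) K) (OriginLocalization K 4))) hpoly
  rw [Ideal.map_span, ← Set.range_comp] at h2
  exact h2

/-! ## §4 The label ideal of a linear frame -/

/-- For a frame `c = (alg (Σ L_{i s} x_s))_{i : Fin (r+2)}` the y-ideal is generated by the images of the first `r` rows. [cite: CossartJannsenSaito2020, Def. 8.4] -/
theorem yIdeal_linearFrame {r : ℕ} (L : Fin (r + 2) → Fin 4 → K) :
    yIdeal (fun i => algebraMap (MvPolynomial (Fin 4) K) (OriginLocalization K 4) (∑ s, C (L i s) * X s)) =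
      (Ideal.span (Set.range fun i : Fin r => (∑ s, C (L (Fin.castAdd 2 i) s) * X s : MvPolynomial (Fin 4) K))).map
        (algebraMap (MvPolynomial (Fin 4) K) (OriginLocalization K 4)) := by
  rw [yIdeal, Ideal.map_span, ← Set.range_comp]
  rfl

/-- **The label condition, polynomial to local**: `G ∈ (ℓ_{y})^d + 𝔪₀^{d+1}` in `K[x]` gives `G/1 ∈ yIdeal c ^ d ⊔ 𝔪^{d+1}` in `𝒪` — the
input of (K-Φ3) IV `factorial_lt_deltaS_of_le_yIdeal_pow_sup` (`δ > 1`). [cite: CossartJannsenSaito2020, Def. 8.4] -/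
theorem algebraMap_mem_yIdeal_pow_sup {r d : ℕ} (L : Fin (r + 2) → Fin 4 → K) {G : MvPolynomial (Fin 4) K}
    (hG : G ∈ Ideal.span (Set.range fun i : Fin r => (∑ s, C (L (Fin.castAdd 2 i) s) * X s : MvPolynomial (Fin 4) K)) ^ d ⊔
      Literature.AlgebraicGeometry.Resolution.originIdeal K 4 ^ (d + 1)) :
    algebraMap (MvPolynomial (Fin 4) K) (OriginLocalization K 4) G ∈
      yIdeal (fun i => algebraMap (MvPolynomial (Fin 4) K) (OriginLocalization K 4) (∑ s, C (L i s) * X s)) ^ d ⊔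
        maximalIdeal (OriginLocalization K 4) ^ (d + 1) := by
  rw [yIdeal_linearFrame, ← Ideal.map_pow, maximalIdeal_originLocalization_eq_map, ← Ideal.map_pow, ← Ideal.map_sup]
  exact Ideal.mem_map_of_mem _ hG

/-- Principal form: `(G/1) ≤ yIdeal c ^ d ⊔ 𝔪^{d+1}` from the polynomial label condition. [cite: CossartJannsenSaito2020, Def. 8.4] -/
theorem span_singleton_algebraMap_le_yIdeal_pow_sup {r d : ℕ} (L : Fin (r + 2) → Fin 4 → K) {G : MvPolynomial (Fin 4) K}
    (hG : G ∈ Ideal.span (Set.range fun i : Fin r => (∑ s, C (L (Fin.castAdd 2 i) s) * X s : MvPolynomial (Fin 4) K)) ^ d ⊔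
      Literature.AlgebraicGeometry.Resolution.originIdeal K 4 ^ (d + 1)) :
    Ideal.span {algebraMap (MvPolynomial (Fin 4) K) (OriginLocalization K 4) G} ≤
      yIdeal (fun i => algebraMap (MvPolynomial (Fin 4) K) (OriginLocalization K 4) (∑ s, C (L i s) * X s)) ^ d ⊔
        maximalIdeal (OriginLocalization K 4) ^ (d + 1) := by
  rw [Ideal.span_singleton_le_iff_mem]
  exact algebraMap_mem_yIdeal_pow_sup L hG

end PhiLine

end Summit.ResolutionOfSingularities.ResolutionOfSingularities.Theorems.PIDim4

end
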